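import Literature.AnabelianGeometry.SemiGraphs.TemperedDLocTransportEquivalence
import Literature.AnabelianGeometry.AbsoluteAnabelian.RigidFunctors
import Literature.AlgebraicGeometry.Frobenioids.Categories
import Mathlib.CategoryTheory.Comma.Over.Basic

/-!
# [SemiAnbd] Thm. 6.8 (ii): the transport equivalences are functorial in `α` up to UNIQUE isomorphism

Mochizuki, *Semi-graphs of anabelioids*, Publ. RIMS **42** (2006) [SemiAnbd], §6, Theorem 6.8 (ii),
author's manuscript p. 74: "Every isomorphism of tempered groups `α : Π^temp_{X_K} ⥲ Π^temp_{Y_L}`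
induces an equivalence of categories `DLoc_{G_K}(Π^temp_{X_K}) ⥲ DLoc_{G_L}(Π^temp_{Y_L})` hence also [by
applying the equivalences of (i)] an equivalence of categories `DLoc_K(X_K) ⥲ DLoc_L(Y_L)` in a fashion
that is functorial, up to unique isomorphisms of equivalences of categories, with respect to `α`."
Proof in print (p. 75): "by exactly the same arguments as those applied in [Mzk8] to prove [Mzk8],
Theorem 2.3", and [Mzk8] = *Galois sections in absolute anabelian geometry* (Nagoya Math. J. 179),
proof of Thm. 2.3 (ii), p. 9: "assertion (ii) follows … formally from the definition of the categories
… [Here, we note that the uniqueness of the isomorphisms of equivalences of categories involved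
follows from Proposition 2.2.]" — Prop. 2.2 (p. 8): for a local field `K` "the categories `DLoc(X_K)`,
`DLoc_K(X_K)` are slim". [cite: MochizukiSemiAnbd2006, Thm 6.8(ii) p.74]

This PROOF-ONLY file (cell abc-iut, layer L3, seat abc-iut-L3-t12 gen 10; no definition, nothing
restated) supplies the clause left as TODO(general form) on `TemperedCurve.IsoInducesDLocEquivalence`
(`TemperedAnabelianMorphisms.lean`) and in `TemperedDLocCategory.lean` / `TemperedDLocTransportEquivalence.lean`
(abc-iut-L3-t4 gen 3: the transport functor `DLocObj.transportFunctor α` and the transport EQUIVALENCE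
`DLocObj.transportEquivalence α`, `(H ↠ H/N) ↦ (α(H) ↠ α(H)/α(N))`), in the two halves print gives it:

* EXISTENCE ("formally from the definition of the categories") — CONSTRUCTED here, stated as
  `Nonempty` to keep the file proof-only: `DLocObj.nonempty_transportFunctor_trans_iso`
  (`T_{β∘α} ≅ T_α ⋙ T_β`: the isomorphisms of tempered groups `(β∘α)(H)/(β∘α)(N) ⥲ β(α(H))/β(α(N))`
  over `G_M`, assembled from abc-iut-L3-t4's `DLocObj.jIso` and `DLocObj.isoOfEquiv`),
  `DLocObj.nonempty_transportFunctor_refl_iso` (`T_{id} ≅ 𝟭`); the inverse law `T_α ⋙ T_{α⁻¹} ≅ 𝟭` is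
  abc-iut-L3-t4's unit/counit.  And "hence also [by applying the equivalences of (i)]":
  `TemperedCurve.nonempty_dlocK_equivalence_of_dlocEquivalence` — the composite equivalence
  `DLoc_K(X_K) ≌ DLoc_L(Y_L)` from Thm. 6.8 (i) for `X_K` and `Y_L` (typed `TemperedCurve.DLocEquivalence`,
  taken BY NAME) and the transport equivalence.
* UNIQUENESS ("follows from Proposition 2.2") — PROVED here MODULO [Mzk8] Prop. 2.2 BY NAME: the
  slimness of the scheme-theoretic category `DLoc_K(X_K)` (the tree's `Frobenioids.IsSlim` at the
  interface datum `D.DLocK` of `DLocSchemeData X` — a displayed hypothesis, not a new definition)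
  transported through the equivalence of Thm. 6.8 (i) (`TemperedCurve.DLocEquivalence`, BY NAME) makes
  `DLoc_{G_K}(Π^temp_{X_K})` id-rigid (`DLocObj.isIdRigid_of_dlocEquivalence_of_isSlim`; the cross-universe
  category theory `isIdRigid_of_isSlim`, `isIdRigid_of_isEquivalence_of_isIdRigid` is proved in §1), hence
  every transport equivalence functor RIGID (`DLocObj.isRigidFunctor_transportEquivalence_functor`) and
  any two isomorphisms from it to a given functor EQUAL (`DLocObj.transportEquivalence_functor_iso_unique`)
  — in particular the functoriality isomorphisms above are unique.

Honest scope: (hΔ) `α(Δ^temp_X) = Δ^temp_Y` and (hI) (= Thm. 6.5 (iii) for `α`, `α⁻¹`) are explicit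
hypotheses as in abc-iut-L3-t4's files; [Mzk8] Prop. 2.2 and Thm. 6.8 (i) are consumed BY NAME
(conditional-by-name ≠ discharged); typed ≠ endorsed; nothing here takes a side on [IUTchIII] Cor. 3.12.
-/

noncomputable section

namespace Literature.AnabelianGeometry.SemiGraphs

open scoped Pointwise
open CategoryTheory Topology
open Literature.AlgebraicGeometry.Frobenioids (IsSlim)
open Literature.AnabelianGeometry.AbsoluteAnabelian (IsRigidFunctor IsIdRigid)

/-! ### 1. Category theory: slim ⇒ id-rigid; id-rigidity descends along an equivalence FUNCTOR across universes -/

section CategoryTheory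

universe v₁ v₂ u₁ u₂

variable {C : Type u₁} [Category.{v₁} C] {D : Type u₂} [Category.{v₂} D]

/-- **A slim category is id-rigid** ([FrdI] §0 p.14 / [SemiAnbd] §0): an automorphism of `𝟭 C`
whiskered with the (rigid) forgetful functor `C_{/A} → C` is trivial, and its component at `A` is the
component of the whiskered automorphism at `𝟙_A`. [cite: MochizukiSemiAnbd2006, §0 p.6] -/
theorem isIdRigid_of_isSlim (hC : IsSlim C) : IsIdRigid C := by
  intro η
  ext A
  -- `η` restricted along the forgetful functor `C_{/A} → C`
  let θ : Over.forget A ≅ Over.forget A :=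
    NatIso.ofComponents (fun U => η.app U.left) (fun f => by simpa using η.hom.naturality f.left)
  have h := congrArg (fun e => e.hom.app (Over.mk (𝟙 A))) (hC.isRigid_forget A θ)
  simp only [θ, NatIso.ofComponents_hom_app, Iso.app_hom, Iso.refl_hom, NatTrans.id_app] at h
  exact h

/-- **Id-rigidity descends along an equivalence functor, across universes**: if `F : C ⥤ D` is an
equivalence (of categories in possibly different universes) and `C` is id-rigid, then `D` is
id-rigid — an automorphism `η` of `𝟭 D` restricted along `F` lifts (fullness) to a natural
(faithfulness) automorphism of `𝟭 C`, which is trivial, so `η_{F A} = 𝟙`; every object is `≅ F A`.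
[cite: MochizukiSemiAnbd2006, §0 p.6] -/
theorem isIdRigid_of_isEquivalence_of_isIdRigid (F : C ⥤ D) [F.IsEquivalence] (hC : IsIdRigid C) :
    IsIdRigid D := by
  intro η
  -- components of `η` at objects `F A` are identities
  have hF : ∀ A : C, η.hom.app (F.obj A) = 𝟙 (F.obj A) := by
    intro A
    let β : 𝟭 C ≅ 𝟭 C := NatIso.ofComponents (fun B => F.preimageIso (η.app (F.obj B)))
      (fun {B B'} f => F.map_injective (by simpa using η.hom.naturality (F.map f)))
    have hβ := congrArg (fun e => e.hom.app A) (hC β)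
    simp only [β, NatIso.ofComponents_hom_app, Functor.preimageIso_hom, Iso.app_hom,
      Iso.refl_hom, NatTrans.id_app, Functor.id_obj] at hβ
    calc η.hom.app (F.obj A) = F.map (F.preimage (η.hom.app (F.obj A))) := (F.map_preimage _).symm
      _ = 𝟙 (F.obj A) := by rw [hβ, F.map_id]
  ext B
  have nat := η.hom.naturality (F.objObjPreimageIso B).hom
  rw [hF] at nat
  simp only [Functor.id_obj, Functor.id_map, Category.id_comp, Iso.refl_hom, NatTrans.id_app] at nat ⊢
  exact (cancel_epi (F.objObjPreimageIso B).hom).1 (nat.trans (Category.comp_id _).symm)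

/-- In an id-rigid category, an isomorphism between a fully faithful functor `Φ` and any functor `Ψ`
is unique ([FrdI] §0 p.15: "any isomorphism between the composite functors in question is necessarily
unique"). [cite: MochizukiSemiAnbd2006, §0 p.6] -/
theorem iso_eq_of_isIdRigid {C' : Type u₁} [Category.{v₁} C'] {Φ Ψ : C ⥤ C'} [Φ.Full] [Φ.Faithful]
    (hC : IsIdRigid C) (e e' : Φ ≅ Ψ) : e = e' := by
  have h := AbsoluteAnabelian.isRigidFunctor_of_full_faithful Φ hC (e ≪≫ e'.symm)
  ext X
  have hX := congrArg (fun i : Φ ≅ Φ => i.hom.app X ≫ e'.hom.app X) h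
  simpa using hX

end CategoryTheory

variable {p : ℕ} [Fact p.Prime]

namespace DLocObj

variable {X Y Z : TemperedCurve p}

/-! ### 2. Functoriality of the transport in `α`: existence of the comparison isomorphisms -/

section Existence

variable (α : X.PiTemp ≃ₜ* Y.PiTemp) (β : Y.PiTemp ≃ₜ* Z.PiTemp)
  (hIα : ∀ I : Subgroup X.PiTemp, X.IsCuspidalGeometricDecompositionGroup I →
    Y.IsCuspidalGeometricDecompositionGroup (I.map α.toMulEquiv.toMonoidHom))
  (hΔα : X.DeltaTemp.map α.toMulEquiv.toMonoidHom = Y.DeltaTemp)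
  (hIβ : ∀ I : Subgroup Y.PiTemp, Y.IsCuspidalGeometricDecompositionGroup I →
    Z.IsCuspidalGeometricDecompositionGroup (I.map β.toMulEquiv.toMonoidHom))
  (hΔβ : Y.DeltaTemp.map β.toMulEquiv.toMonoidHom = Z.DeltaTemp)

/-- `(β ∘ α)(I) = β(α(I))`. [cite: MochizukiSemiAnbd2006, Thm 6.8(ii) p.74] -/
theorem map_trans (I : Subgroup X.PiTemp) :
    I.map (α.trans β).toMulEquiv.toMonoidHom =
      (I.map α.toMulEquiv.toMonoidHom).map β.toMulEquiv.toMonoidHom := by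
  rw [Subgroup.map_map]; rfl

include hIα hIβ in
/-- (hI) for `β ∘ α` from (hI) for `α` and for `β`. [cite: MochizukiSemiAnbd2006, Thm 6.8(ii) p.74] -/
theorem hI_trans : ∀ I : Subgroup X.PiTemp, X.IsCuspidalGeometricDecompositionGroup I →
    Z.IsCuspidalGeometricDecompositionGroup (I.map (α.trans β).toMulEquiv.toMonoidHom) := by
  intro I h
  rw [map_trans]
  exact hIβ _ (hIα I h)

include hΔα hΔβ in
/-- (hΔ) for `β ∘ α` from (hΔ) for `α` and for `β`. [cite: MochizukiSemiAnbd2006, Thm 6.8(ii) p.74] -/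
theorem hΔ_trans : X.DeltaTemp.map (α.trans β).toMulEquiv.toMonoidHom = Z.DeltaTemp := by
  rw [map_trans, hΔα, hΔβ]

/-- **`T_{β∘α} ≅ T_α ⋙ T_β`**: the transport functors along isomorphisms of tempered groups compose up to
the natural isomorphism whose component at `H ↠ J` is the isomorphism of tempered groups
`(β∘α)(H)/(β∘α)(N) ⥲ β(α(H))/β(α(N))` over `G_M` (both receive `J` through the `jIso`'s) — Thm. 6.8 (ii)
"functorial … with respect to `α`", existence half ("formally from the definition of the categories",
[Mzk8] p.9); for ANY admissible hypotheses (hI), (hΔ) attached to `β ∘ α`.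
[cite: MochizukiSemiAnbd2006, Thm 6.8(ii) p.74] -/
theorem nonempty_transportFunctor_trans_iso
    (hIγ : ∀ I : Subgroup X.PiTemp, X.IsCuspidalGeometricDecompositionGroup I →
      Z.IsCuspidalGeometricDecompositionGroup (I.map (α.trans β).toMulEquiv.toMonoidHom))
    (hΔγ : X.DeltaTemp.map (α.trans β).toMulEquiv.toMonoidHom = Z.DeltaTemp) :
    letI := dlocCategory X; letI := dlocCategory Y; letI := dlocCategory Z
    Nonempty (transportFunctor (α.trans β) hIγ hΔγ ≅
      transportFunctor α hIα hΔα ⋙ transportFunctor β hIβ hΔβ) := by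
  letI := dlocCategory X; letI := dlocCategory Y; letI := dlocCategory Z
  -- the comparison isomorphism of tempered groups at an object, and that it lies over `G_M`
  let e : ∀ A : DLocObj X,
      (A.transport (α.trans β) hIγ hΔγ).J ≃ₜ* ((A.transport α hIα hΔα).transport β hIβ hΔβ).J :=
    fun A => (jIso (α.trans β) hIγ hΔγ A).symm.trans
      ((jIso α hIα hΔα A).trans (jIso β hIβ hΔβ (A.transport α hIα hΔα)))
  have he_apply : ∀ (A : DLocObj X) (j : A.J),
      e A (jIso (α.trans β) hIγ hΔγ A j) = jIso β hIβ hΔβ _ (jIso α hIα hΔα A j) := by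
    intro A j
    simp [e]
  have he : ∀ (A : DLocObj X) (j' : (A.transport (α.trans β) hIγ hΔγ).J),
      ((A.transport α hIα hΔα).transport β hIβ hΔβ).augJ (e A j') =
        (A.transport (α.trans β) hIγ hΔγ).augJ j' := by
    intro A j'
    obtain ⟨j, rfl⟩ := (jIso (α.trans β) hIγ hΔγ A).surjective j'
    rw [he_apply]
    induction j using QuotientGroup.induction_on with
    | H h => rfl
  refine ⟨NatIso.ofComponents (fun A => isoOfEquiv (e A) (he A)) ?_⟩
  rintro A B ⟨φ⟩
  refine Quotient.sound ⟨1, fun j' => ?_⟩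
  rw [one_mul, inv_one, mul_one]
  obtain ⟨j, rfl⟩ := (jIso (α.trans β) hIγ hΔγ A).surjective j'
  change jIso β hIβ hΔβ _ (jIso α hIα hΔα B (φ.toHom ((jIso α hIα hΔα A).symm
      ((jIso β hIβ hΔβ (A.transport α hIα hΔα)).symm (e A (jIso (α.trans β) hIγ hΔγ A j)))))) =
    e B (jIso (α.trans β) hIγ hΔγ B (φ.toHom ((jIso (α.trans β) hIγ hΔγ A).symm
      (jIso (α.trans β) hIγ hΔγ A j))))
  rw [he_apply, he_apply, ContinuousMulEquiv.symm_apply_apply, ContinuousMulEquiv.symm_apply_apply,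
    ContinuousMulEquiv.symm_apply_apply]

/-- **`T_{id} ≅ 𝟭`**: transport along the identity isomorphism is naturally isomorphic to the identity
functor (component at `H ↠ J`: the inverse of `jIso`, `id(H)/id(N) ⥲ H/N`, over `G_K`); for ANY
admissible hypotheses attached to the identity. [cite: MochizukiSemiAnbd2006, Thm 6.8(ii) p.74] -/
theorem nonempty_transportFunctor_refl_iso
    (hI₁ : ∀ I : Subgroup X.PiTemp, X.IsCuspidalGeometricDecompositionGroup I →
      X.IsCuspidalGeometricDecompositionGroup
        (I.map (ContinuousMulEquiv.refl X.PiTemp).toMulEquiv.toMonoidHom))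
    (hΔ₁ : X.DeltaTemp.map (ContinuousMulEquiv.refl X.PiTemp).toMulEquiv.toMonoidHom = X.DeltaTemp) :
    letI := dlocCategory X
    Nonempty (transportFunctor (ContinuousMulEquiv.refl X.PiTemp) hI₁ hΔ₁ ≅ 𝟭 (DLocObj X)) := by
  letI := dlocCategory X
  have he : ∀ (A : DLocObj X) (j' : (A.transport _ hI₁ hΔ₁).J),
      A.augJ ((jIso _ hI₁ hΔ₁ A).symm j') = (A.transport _ hI₁ hΔ₁).augJ j' := by
    intro A j'
    obtain ⟨j, rfl⟩ := (jIso _ hI₁ hΔ₁ A).surjective j'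
    rw [ContinuousMulEquiv.symm_apply_apply]
    induction j using QuotientGroup.induction_on with
    | H h => rfl
  refine ⟨NatIso.ofComponents (fun A => isoOfEquiv (jIso _ hI₁ hΔ₁ A).symm (he A)) ?_⟩
  rintro A B ⟨φ⟩
  refine Quotient.sound ⟨1, fun j' => ?_⟩
  rw [one_mul, inv_one, mul_one]
  change φ.toHom ((jIso _ hI₁ hΔ₁ A).symm j') =
    (jIso _ hI₁ hΔ₁ B).symm (jIso _ hI₁ hΔ₁ B (φ.toHom ((jIso _ hI₁ hΔ₁ A).symm j')))
  rw [ContinuousMulEquiv.symm_apply_apply]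

/-- The hypotheses attached to the identity isomorphism hold trivially: (hI).
[cite: MochizukiSemiAnbd2006, Thm 6.8(ii) p.74] -/
theorem hI_refl : ∀ I : Subgroup X.PiTemp, X.IsCuspidalGeometricDecompositionGroup I →
    X.IsCuspidalGeometricDecompositionGroup
      (I.map (ContinuousMulEquiv.refl X.PiTemp).toMulEquiv.toMonoidHom) := by
  intro I h
  convert h
  exact Subgroup.map_id I

/-- The hypotheses attached to the identity isomorphism hold trivially: (hΔ).
[cite: MochizukiSemiAnbd2006, Thm 6.8(ii) p.74] -/
theorem hΔ_refl :
    X.DeltaTemp.map (ContinuousMulEquiv.refl X.PiTemp).toMulEquiv.toMonoidHom = X.DeltaTemp :=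
  Subgroup.map_id _

end Existence

/-! ### 3. Uniqueness of the isomorphisms ⟸ [Mzk8] Prop. 2.2 (slimness of `DLoc_K(X_K)`) through Thm. 6.8 (i) -/

section Uniqueness

variable (α : X.PiTemp ≃ₜ* Y.PiTemp)
  (hΔ : X.DeltaTemp.map α.toMulEquiv.toMonoidHom = Y.DeltaTemp)
  (hI : ∀ I : Subgroup X.PiTemp, X.IsCuspidalGeometricDecompositionGroup I ↔
    Y.IsCuspidalGeometricDecompositionGroup (I.map α.toMulEquiv.toMonoidHom))

/-- **`DLoc_{G_K}(Π^temp_{X_K})` is id-rigid ⟸ [Mzk8] Prop. 2.2 + Thm. 6.8 (i)** (both BY NAME): if the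
scheme-theoretic category `DLoc_K(X_K)` of a genuine-morphism datum `D` is slim ([Mzk8] Prop. 2.2:
"the categories `DLoc(X_K)`, `DLoc_K(X_K)` are slim") and the tempered fundamental group functor
`DLoc_K(X_K) → DLoc_{G_K}(Π^temp_{X_K})` is an equivalence (Thm. 6.8 (i) as typed,
`TemperedCurve.DLocEquivalence`), then the identity functor of `DLoc_{G_K}(Π^temp_{X_K})`
(`DLocObj.dlocCategory X`) has no non-trivial automorphism. [cite: MochizukiSemiAnbd2006, Thm 6.8(i)-(ii) p.74] -/
theorem isIdRigid_of_dlocEquivalence_of_isSlim (D : DLocSchemeData X)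
    (hslim : letI := D.catK; IsSlim D.DLocK) (h68i : X.DLocEquivalence D.toDLocContext) :
    letI := dlocCategory X; IsIdRigid (DLocObj X) := by
  letI := D.catK
  letI := dlocCategory X
  haveI : D.pi1Functor.IsEquivalence := h68i
  exact isIdRigid_of_isEquivalence_of_isIdRigid D.pi1Functor (isIdRigid_of_isSlim hslim)

/-- **The transport equivalence functor `T_α` is RIGID** (no non-trivial automorphism) as soon as
`DLoc_{G_K}(Π^temp_{X_K})` is id-rigid — e.g. under [Mzk8] Prop. 2.2 + Thm. 6.8 (i)
(`isIdRigid_of_dlocEquivalence_of_isSlim`). [cite: MochizukiSemiAnbd2006, Thm 6.8(ii) p.74] -/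
theorem isRigidFunctor_transportEquivalence_functor
    (hX : letI := dlocCategory X; IsIdRigid (DLocObj X)) :
    letI := dlocCategory X; letI := dlocCategory Y
    IsRigidFunctor (transportEquivalence α hΔ hI).functor := by
  letI := dlocCategory X; letI := dlocCategory Y
  exact AbsoluteAnabelian.isRigidFunctor_of_full_faithful _ hX

/-- **Uniqueness of the isomorphisms of equivalences of categories** (Thm. 6.8 (ii): "functorial, up
to UNIQUE isomorphisms of equivalences of categories"; [Mzk8] p.9: "the uniqueness … follows from
Proposition 2.2"): if `DLoc_{G_K}(Π^temp_{X_K})` is id-rigid, any two isomorphisms from the transport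
equivalence functor `T_α` to a functor `G` coincide — so the comparison isomorphisms
`T_{β∘α} ≅ T_α ⋙ T_β`, `T_{id} ≅ 𝟭`, `T_α ⋙ T_{α⁻¹} ≅ 𝟭` of this file and of abc-iut-L3-t4's are the
unique ones. [cite: MochizukiSemiAnbd2006, Thm 6.8(ii) p.74] -/
theorem transportEquivalence_functor_iso_unique
    (hX : letI := dlocCategory X; IsIdRigid (DLocObj X)) :
    letI := dlocCategory X; letI := dlocCategory Y
    ∀ (G : DLocObj X ⥤ DLocObj Y) (e e' : (transportEquivalence α hΔ hI).functor ≅ G), e = e' := by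
  letI := dlocCategory X; letI := dlocCategory Y
  intro G e e'
  exact iso_eq_of_isIdRigid hX e e'

/-- **Thm. 6.8 (ii), uniqueness clause, ⟸ [Mzk8] Prop. 2.2 + Thm. 6.8 (i) BY NAME**: for a
genuine-morphism datum `D` with `DLoc_K(X_K)` slim and `DLoc_K(X_K) → DLoc_{G_K}(Π^temp_{X_K})` an
equivalence, isomorphisms from the transport equivalence functor along any `α` to any functor are
unique. [cite: MochizukiSemiAnbd2006, Thm 6.8(ii) p.74] -/
theorem transportEquivalence_functor_iso_unique_of_isSlim (D : DLocSchemeData X)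
    (hslim : letI := D.catK; IsSlim D.DLocK) (h68i : X.DLocEquivalence D.toDLocContext) :
    letI := dlocCategory X; letI := dlocCategory Y
    ∀ (G : DLocObj X ⥤ DLocObj Y) (e e' : (transportEquivalence α hΔ hI).functor ≅ G), e = e' :=
  transportEquivalence_functor_iso_unique α hΔ hI (isIdRigid_of_dlocEquivalence_of_isSlim D hslim h68i)

end Uniqueness

end DLocObj

/-! ### 4. "hence also [by applying the equivalences of (i)] an equivalence `DLoc_K(X_K) ⥲ DLoc_L(Y_L)`" -/

namespace TemperedCurve

variable {X Y : TemperedCurve p}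

/-- **Thm. 6.8 (ii), the scheme-level equivalence `DLoc_K(X_K) ≌ DLoc_L(Y_L)`** "by applying the
equivalences of (i)": for genuine-morphism data `DX`, `DY` with Thm. 6.8 (i) for both (typed
`TemperedCurve.DLocEquivalence`, BY NAME) and `α` with (hΔ), (hI), the composite
`DLoc_K(X_K) ≌ DLoc_{G_K}(Π^temp_{X_K}) ≌ DLoc_{G_L}(Π^temp_{Y_L}) ≌ DLoc_L(Y_L)`.
[cite: MochizukiSemiAnbd2006, Thm 6.8(ii) p.74] -/
theorem nonempty_dlocK_equivalence_of_dlocEquivalence (DX : DLocSchemeData X) (DY : DLocSchemeData Y)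
    (hX : X.DLocEquivalence DX.toDLocContext) (hY : Y.DLocEquivalence DY.toDLocContext)
    (α : X.PiTemp ≃ₜ* Y.PiTemp) (hΔ : X.DeltaTemp.map α.toMulEquiv.toMonoidHom = Y.DeltaTemp)
    (hI : ∀ I : Subgroup X.PiTemp, X.IsCuspidalGeometricDecompositionGroup I ↔
      Y.IsCuspidalGeometricDecompositionGroup (I.map α.toMulEquiv.toMonoidHom)) :
    letI := DX.catK; letI := DY.catK; Nonempty (DX.DLocK ≌ DY.DLocK) := by
  letI := DX.catK; letI := DY.catK
  letI := DLocObj.dlocCategory X; letI := DLocObj.dlocCategory Y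
  haveI : DX.pi1Functor.IsEquivalence := hX
  haveI : DY.pi1Functor.IsEquivalence := hY
  exact ⟨DX.pi1Functor.asEquivalence.trans
    ((DLocObj.transportEquivalence α hΔ hI).trans DY.pi1Functor.asEquivalence.symm)⟩

/-- **The scheme-level equivalences are also unique up to unique isomorphism** ⟸ [Mzk8] Prop. 2.2 BY
NAME: if `DLoc_L(Y_L)` is slim, any two isomorphisms between an equivalence functor
`DLoc_K(X_K) ⥤ DLoc_L(Y_L)` and a given functor coincide (its source is then id-rigid).
[cite: MochizukiSemiAnbd2006, Thm 6.8(ii) p.74] -/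
theorem dlocK_equivalence_functor_iso_unique (DX : DLocSchemeData X) (DY : DLocSchemeData Y)
    (hslim : letI := DY.catK; IsSlim DY.DLocK) :
    letI := DX.catK; letI := DY.catK
    ∀ (E : DX.DLocK ≌ DY.DLocK) (G : DX.DLocK ⥤ DY.DLocK) (e e' : E.functor ≅ G), e = e' := by
  letI := DX.catK; letI := DY.catK
  intro E G e e'
  have hXr : IsIdRigid DX.DLocK :=
    isIdRigid_of_isEquivalence_of_isIdRigid E.inverse (isIdRigid_of_isSlim hslim)
  exact iso_eq_of_isIdRigid hXr e e'

end TemperedCurve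

end Literature.AnabelianGeometry.SemiGraphs

end
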